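import Summits.MatrixMultiplication.OmegaCensus.STPPVosperSlackTwoLawT
import Summits.MatrixMultiplication.OmegaCensus.STPPVosperSlackTwoRows59L1AAsm
import Summits.MatrixMultiplication.OmegaCensus.STPPVosperSlackTwoRows59L1CAsm
import Summits.MatrixMultiplication.OmegaCensus.STPPVosperSlackTwoRows59L1TblAAsm
import Summits.MatrixMultiplication.OmegaCensus.STPPVosperTilingWordsPrunedQ
import Summits.MatrixMultiplication.OmegaCensus.STPPHamidouneRodsethInverseTheorem

/-!
# ω-census (abelian STPP census): `{(2,2,2),(3,3,3),(3,3,3)} ⊄ ℤ₅₉` by the slack-2 partition law, table form (kernel, unconditional)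

HONEST FRAMING (pub-omega census; verbatim): lottery ticket; floor = certified bounds/negative ranges.
Census EXCLUSION (seat pub-omega-stpp-1 gen 33 with the rows of seat pub-omega-stpp-2 gen 27, 2026-08-28), family (b2).  The three-block leaf
`{(2,2,2),(3,3,3),(3,3,3)}` of the ℤ₅₉ STPP census (slack 2 at a `(3,3,3)` block: `z + b + vol + a + L = 13 + 3 + 27 + 3 + 13 = 59`) has NO realisation:
`no_isSTPP_of_slack_two_tables` (`STPPVosperSlackTwoLawT.lean`) at block `1` read `(a, b, c) = (3, 3, 3)`, other blocks `[2, 0]` of sizes `(3,3,3)`,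
`(2,2,2)`, with the kernel rows `rows59L1A_choose` (case A = case B′ — the pattern is symmetric under the role swap; 290 dihedral representatives of the
1 653 three-shapes), `rows59L1C_lit` (case C, `qShapesC 3 × pShapesC 59 3 × 13` holes, EMPTY table) and the words-cover rows `dead59L1A` for the two table
entries (`STPPVosperSlackTwoRows59L1*.lean`, seat stpp-2 gen 27; tables `STPPVosperSlackTwoTablesZ59.lean`).  Hamidoune–Rødseth is the tree theorem
`hamidouneRodsethInverseTheorem_holds`.  Census consequence (lead's words only): one of the three open ℤ₅₉ leaves.  Nothing here is progress on `ω`.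

References: H. Cohn, R. Kleinberg, B. Szegedy, C. Umans, FOCS 2005 (arXiv:math/0511460), Def. 5.1; A. G. Vosper, J. London Math. Soc. 31 (1956);
Y. O. Hamidoune, Ø. J. Rødseth, Acta Arith. 92 (2000).
-/

open Finset
open scoped Pointwise

namespace Summit.MatrixMultiplication.OmegaCensus.CubeNB

open Literature.Computability.AlgebraicComplexity
open Literature.Combinatorics.Additive
open Summit.MatrixMultiplication.OmegaCensus.STPPKneser
open Summit.MatrixMultiplication.OmegaCensus.CubeNB.S2

/-- **`{(2,2,2),(3,3,3),(3,3,3)} ⊄ ℤ₅₉` (kernel, unconditional).**  No simultaneous-triple-product family of `ℤ/59` has size pattern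
`(|A₀|,|B₀|,|C₀|) = (2,2,2)`, `(|A₁|,|B₁|,|C₁|) = (|A₂|,|B₂|,|C₂|) = (3,3,3)`. [cite: CohnKleinbergSzegedyUmans2005, Def. 5.1]
[cite: Vosper1956, main theorem; Nathanson1996, Thm 2.7] [cite: HamidouneRodseth2000, main theorem (§1, p. 252)] -/
theorem no_isSTPP_zmod59_222_333_333 (A B C : Fin 3 → Finset (ZMod 59)) (hS : IsSTPP A B C)
    (hA : ∀ i, #(A i) = ![2, 3, 3] i) (hB : ∀ i, #(B i) = ![2, 3, 3] i) (hC : ∀ i, #(C i) = ![2, 3, 3] i) : False := by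
  haveI : Fact (Nat.Prime 59) := ⟨by norm_num⟩
  have hAne : ∀ i, (A i).Nonempty := fun i => card_pos.1 (by rw [hA]; fin_cases i <;> simp)
  have hBne : ∀ i, (B i).Nonempty := fun i => card_pos.1 (by rw [hB]; fin_cases i <;> simp)
  have hCne : ∀ i, (C i).Nonempty := fun i => card_pos.1 (by rw [hC]; fin_cases i <;> simp)
  have e1 : (univ : Finset (Fin 3)).erase 1 = {0, 2} := by decide
  have hz : ∑ k ∈ (univ : Finset (Fin 3)).erase 1, #(A k) * #(C k) = 13 := by
    rw [e1, Finset.sum_pair (by decide)]; simp [hA, hC]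
  have hL : ∑ k ∈ (univ : Finset (Fin 3)).erase 1, #(B k) * #(C k) = 13 := by
    rw [e1, Finset.sum_pair (by decide)]; simp [hB, hC]
  have hszsA : ([2, 0] : List (Fin 3)).map (fun k => (#(A k), #(B k), #(C k))) = [(3, 3, 3), (2, 2, 2)] := by simp [hA, hB, hC]
  have hszsB : ([2, 0] : List (Fin 3)).map (fun k => (#(B k), #(A k), #(C k))) = [(3, 3, 3), (2, 2, 2)] := by simp [hA, hB, hC]
  have hdead : ∀ e ∈ tblZ59L1A, CoverDead 59 3 1 [(3, 3, 3), (2, 2, 2)] e.1 e.2 :=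
    coverDead_forall_of_rows (blockEnumSound_blockDiffsWQ 59) fun e he => dead59L1A e he
  exact no_isSTPP_of_slack_two_tables hamidouneRodsethInverseTheorem_holds hS hAne hBne hCne 1 ⟨0, by decide⟩
    (a := 3) (b := 3) (c := 3) (L := 13) (z := 13) (vol := 27) (tblA := tblZ59L1A) (tblB := tblZ59L1A) (tblC := [])
    (by rw [hA]; rfl) (by rw [hB]; rfl) (by rw [hC]; rfl) hz hL rfl (by norm_num)
    (Or.inr ⟨le_rfl, by norm_num, by norm_num⟩) (by norm_num) (by norm_num) (by norm_num) (by norm_num)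
    [2, 0] (by decide) (fun k => by fin_cases k <;> decide) hszsA hszsB hdead hdead (fun e he => by simp at he)
    rows59L1A_choose rows59L1A_choose (fun Q hQ P hP h hh => Or.inl (rows59L1C_lit Q hQ P hP h hh))

end Summit.MatrixMultiplication.OmegaCensus.CubeNB
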